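import Literature.Probability.Percolation.ZdFourArmSepInit
import Literature.Probability.Percolation.ZdFourArmSepInwardExtProb
import HarnessLib

/-!
# Kesten's well-separated four-arm event has positive probability at bounded ratio (bond percolation on `ℤ²`), probabilistic half

Topic `Literature/Probability/Percolation`; critical bond percolation on `ℤ²`
(`bondPercolation (zdGraph 2) half`). Proofs and two auxiliary pair-set definitions (no named fact).

The **initial-scale input of the internal half of Kesten's arm-separation theorem** for four
alternating arms (H. Kesten, CMP 109 (1987), §2, Lemma 5; P. Nolin, EJP 13 (2008), §4.3 Prop. 13,
lower bound: "comes from iterating item (i) [extendability]", and §4.4; here one explicit RSW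
construction): for `64 ≤ m` and `2m ≤ N ≤ 8m`,

  `c²⁸ ≤ P_{1/2}(zdFourArmSep m N)`,   `c = c(512) > 0` the RSW constant (`rsw_lowerBound_holds 512`),

i.e. the hypothesis `hinit` of the inward multi-scale summation
(`real_fourArmTwoClusters_le_mul_of_scheme_inner`, `ZdFourArmSeparationStep.lean`) run on the fenced
events.  The deterministic half is `mem_zdFourArmSep_of_mem_init` (`ZdFourArmSepInit.lean`); here the
fourteen open events (increasing, read off pairs near the `x`-axis with `|x₀| ≥ m - m/8 + 1`) and the
fourteen closed-dual events (decreasing, read off pairs near the `y`-axis with `|x₀| ≤ 2·N/64 + 1`) are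
bounded below by Harris' inequality and RSW (`≥ c¹⁴` each) and are independent (disjoint pair sets,
`bondPercolation_real_inter_of_disjoint`).

* `initOpenPairs`, `initDualPairs`, `initOpenPairs_sites`, `initDualPairs_sites`, `disjoint_initPairs`,
  `determinedBy_initOpenEvents`, `determinedBy_initDualEvents`;
* `le_real_initOpenEvents`, `le_real_initDualEvents` (`≥ c¹⁴`);
* **`le_real_zdFourArmSep_init`** (`c²⁸ ≤ P(zdFourArmSep m N)`) and **`exists_le_real_zdFourArmSep_init`**.

## References

* P. Nolin, *Near-critical percolation in two dimensions*, EJP 13 (2008), §4.3 Prop. 12 (i), Prop. 13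
  [arXiv 0711.4948: Prop. 11, Prop. 12]. [Nolin2008]
* H. Kesten, *Scaling relations for 2D-percolation*, CMP 109 (1987), §2, Lemma 5. [KestenScalingCMP1987]
* B. Bollobás, O. Riordan, *Percolation* (2006), Ch. 3, eq. (3) (RSW). [BollobasRiordan2006]
-/

noncomputable section

open MeasureTheory Set SimpleGraph

namespace Literature.Probability.Percolation

open LatticeModels

/-! ### The pairs read by the twenty-eight events -/

section Pairs

/-- The pairs read by the fourteen open events. [folklore] -/
def initOpenPairs (m N : ℕ) : Finset (Sym2 (Site 2)) :=
  (((rectangle (N - m) (m / 64)).image (· + (![(m : ℤ), 0] : Site 2))).sym2 ∪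
      ((rectangle (m / 8 - 1 + m / 16) (m / 64)).image (· + (![(m : ℤ) - (m / 8 : ℕ) + 1, 0] : Site 2))).sym2 ∪
      (((rectangle (m / 16 - 1) (3 * (m / 64))).image (· + (![(m : ℤ) + 1, -((m / 64 : ℕ) : ℤ)] : Site 2))).sym2 ∪
        ((rectangle (m / 8 - 2) (3 * (m / 64))).image (· + (![(m : ℤ) - (m / 8 : ℕ) + 1, -((m / 64 : ℕ) : ℤ)] : Site 2))).sym2) ∪
    (((rectangle (N / 16 + N / 8 - 1) (N / 64)).image (· + (![(N : ℤ) - (N / 16 : ℕ), 0] : Site 2))).sym2 ∪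
      (((rectangle (N / 16 - 1) (3 * (N / 64))).image (· + (![(N : ℤ) - (N / 16 : ℕ), -((N / 64 : ℕ) : ℤ)] : Site 2))).sym2 ∪
        ((rectangle (N / 8 - 2) (3 * (N / 64))).image (· + (![(N : ℤ) + 1, -((N / 64 : ℕ) : ℤ)] : Site 2))).sym2))) ∪
  (((rectangle (N - m) (m / 64)).image (· + (![-(N : ℤ), 0] : Site 2))).sym2 ∪
      ((rectangle (m / 8 - 1 + m / 16) (m / 64)).image (· + (![-((m : ℤ) + (m / 16 : ℕ)), 0] : Site 2))).sym2 ∪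
      (((rectangle (m / 16 - 1) (3 * (m / 64))).image (· + (![-((m : ℤ) + (m / 16 : ℕ)), -((m / 64 : ℕ) : ℤ)] : Site 2))).sym2 ∪
        ((rectangle (m / 8 - 2) (3 * (m / 64))).image (· + (![-(m : ℤ) + 1, -((m / 64 : ℕ) : ℤ)] : Site 2))).sym2) ∪
    (((rectangle (N / 16 + N / 8 - 1) (N / 64)).image (· + (![-(N : ℤ) - (N / 8 : ℕ) + 1, 0] : Site 2))).sym2 ∪
      (((rectangle (N / 16 - 1) (3 * (N / 64))).image (· + (![-(N : ℤ) + 1, -((N / 64 : ℕ) : ℤ)] : Site 2))).sym2 ∪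
        ((rectangle (N / 8 - 2) (3 * (N / 64))).image (· + (![-(N : ℤ) - (N / 8 : ℕ) + 1, -((N / 64 : ℕ) : ℤ)] : Site 2))).sym2)))

/-- The pairs read by the fourteen closed-dual events. [folklore] -/
def initDualPairs (m N : ℕ) : Finset (Sym2 (Site 2)) :=
  (dualFaceCrossingPairs ![0, (m : ℤ)] (m / 64 + 1) (N - m) ∪
      dualLRFaceCrossingPairs ![-((m / 64 : ℕ) : ℤ), (m : ℤ)] (3 * (m / 64)) (m / 16 - 1) ∪
      (dualFaceCrossingPairs ![0, (m : ℤ) - (m / 8 : ℕ) + 1] (m / 64 + 1) (m / 16 + m / 8 - 2) ∪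
        dualLRFaceCrossingPairs ![-((m / 64 : ℕ) : ℤ), (m : ℤ) - (m / 8 : ℕ)] (3 * (m / 64)) (m / 8 - 2)) ∪
    (dualLRFaceCrossingPairs ![-((N / 64 : ℕ) : ℤ), (N : ℤ) - (N / 16 : ℕ) + 1] (3 * (N / 64)) (N / 16 - 2) ∪
      (dualFaceCrossingPairs ![0, (N : ℤ) - (N / 16 : ℕ) + 2] (N / 64 + 1) (N / 16 + N / 8 - 3) ∪
        dualLRFaceCrossingPairs ![-((N / 64 : ℕ) : ℤ), (N : ℤ) + 1] (3 * (N / 64)) (N / 8 - 2)))) ∪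
  (dualFaceCrossingPairs ![0, -(N : ℤ)] (m / 64 + 1) (N - m) ∪
      dualLRFaceCrossingPairs ![-((m / 64 : ℕ) : ℤ), -(m : ℤ) - (m / 16 : ℕ) + 1] (3 * (m / 64)) (m / 16 - 2) ∪
      (dualFaceCrossingPairs ![0, -(m : ℤ) - (m / 16 : ℕ) + 2] (m / 64 + 1) (m / 16 + m / 8 - 3) ∪
        dualLRFaceCrossingPairs ![-((m / 64 : ℕ) : ℤ), -(m : ℤ) + 1] (3 * (m / 64)) (m / 8 - 2)) ∪
    (dualLRFaceCrossingPairs ![-((N / 64 : ℕ) : ℤ), -(N : ℤ)] (3 * (N / 64)) (N / 16 - 2) ∪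
      (dualFaceCrossingPairs ![0, -(N : ℤ) - (N / 8 : ℕ) + 1] (N / 64 + 1) (N / 16 + N / 8 - 3) ∪
        dualLRFaceCrossingPairs ![-((N / 64 : ℕ) : ℤ), -(N : ℤ) - (N / 8 : ℕ)] (3 * (N / 64)) (N / 8 - 2))))

variable {m N : ℕ}

/-- **Sites of the open pairs**: `|x₁| ≤ 2·N/64` and `m - m/8 + 1 ≤ |x₀| ≤ N + N/8 - 1`. [folklore] -/
theorem initOpenPairs_sites (hm : 64 ≤ m) (hmN : 2 * m ≤ N) {e : Sym2 (Site 2)}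
    (he : e ∈ initOpenPairs m N) {x : Site 2} (hx : x ∈ e) :
    |x 1| ≤ 2 * ((N / 64 : ℕ) : ℤ) ∧ (m : ℤ) - (m / 8 : ℕ) + 1 ≤ |x 0| ∧ |x 0| + 1 ≤ (N : ℤ) + (N / 8 : ℕ) := by
  have hdiv : m / 64 ≤ N / 64 := Nat.div_le_div_right (by omega)
  simp only [initOpenPairs, Finset.mem_union] at he
  rcases he with (((he | he) | (he | he)) | (he | (he | he))) | (((he | he) | (he | he)) | (he | (he | he))) <;>
    have h := apply_le_of_mem_rectanglePairs he hx <;>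
    simp only [Matrix.cons_val_zero, Matrix.cons_val_one] at h <;>
    (first
      | exact ⟨abs_le.2 ⟨by omega, by omega⟩, by rw [abs_of_nonneg (by omega)]; omega,
          by rw [abs_of_nonneg (by omega)]; omega⟩
      | exact ⟨abs_le.2 ⟨by omega, by omega⟩, by rw [abs_of_nonpos (by omega)]; omega,
          by rw [abs_of_nonpos (by omega)]; omega⟩)

/-- **Sites of the dual pairs**: `|x₀| ≤ 2·N/64 + 1` and `m - m/8 ≤ |x₁| ≤ N + N/8`. [folklore] -/
theorem initDualPairs_sites (hm : 64 ≤ m) (hmN : 2 * m ≤ N) {e : Sym2 (Site 2)}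
    (he : e ∈ initDualPairs m N) {x : Site 2} (hx : x ∈ e) :
    |x 0| ≤ 2 * ((N / 64 : ℕ) : ℤ) + 1 ∧ (m : ℤ) - (m / 8 : ℕ) ≤ |x 1| ∧ |x 1| ≤ (N : ℤ) + (N / 8 : ℕ) := by
  have hdiv : m / 64 ≤ N / 64 := Nat.div_le_div_right (by omega)
  simp only [initDualPairs, Finset.mem_union] at he
  rcases he with (((he | he) | (he | he)) | (he | (he | he))) | (((he | he) | (he | he)) | (he | (he | he))) <;>
    [have h := apply_le_of_mem_dualFaceCrossingPairs he hx;
      have h := apply_le_of_mem_dualLRFaceCrossingPairs he hx;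
      have h := apply_le_of_mem_dualFaceCrossingPairs he hx;
      have h := apply_le_of_mem_dualLRFaceCrossingPairs he hx;
      have h := apply_le_of_mem_dualLRFaceCrossingPairs he hx;
      have h := apply_le_of_mem_dualFaceCrossingPairs he hx;
      have h := apply_le_of_mem_dualLRFaceCrossingPairs he hx;
      have h := apply_le_of_mem_dualFaceCrossingPairs he hx;
      have h := apply_le_of_mem_dualLRFaceCrossingPairs he hx;
      have h := apply_le_of_mem_dualFaceCrossingPairs he hx;
      have h := apply_le_of_mem_dualLRFaceCrossingPairs he hx;
      have h := apply_le_of_mem_dualLRFaceCrossingPairs he hx;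
      have h := apply_le_of_mem_dualFaceCrossingPairs he hx;
      have h := apply_le_of_mem_dualLRFaceCrossingPairs he hx] <;>
    simp only [Matrix.cons_val_zero, Matrix.cons_val_one] at h <;>
    (first
      | exact ⟨abs_le.2 ⟨by omega, by omega⟩, by rw [abs_of_nonneg (by omega)]; omega,
          by rw [abs_of_nonneg (by omega)]; omega⟩
      | exact ⟨abs_le.2 ⟨by omega, by omega⟩, by rw [abs_of_nonpos (by omega)]; omega,
          by rw [abs_of_nonpos (by omega)]; omega⟩)

/-- The open and dual pairs are disjoint when `N ≤ 8m` (open sites have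
`|x₀| ≥ m - m/8 + 1 > 2·N/64 + 1`). [folklore] -/
theorem disjoint_initPairs (hm : 64 ≤ m) (hmN : 2 * m ≤ N) (hN8 : N ≤ 8 * m) :
    Disjoint (initOpenPairs m N) (initDualPairs m N) := by
  rw [Finset.disjoint_left]
  intro e heP heM
  obtain ⟨x, hx⟩ : ∃ x, x ∈ e := ⟨e.out.1, Sym2.out_fst_mem e⟩
  have h1 := initOpenPairs_sites hm hmN heP hx
  have h2 := initDualPairs_sites hm hmN heM hx
  omega

/-- The open events are determined by the open pairs. [folklore] -/
theorem determinedBy_initOpenEvents (m N : ℕ) :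
    DeterminedBy (initOpenEvents m N) ↑(initOpenPairs m N) := by
  unfold initOpenEvents initOpenPairs
  exact ((((determinedBy_openCrossing_image _ _ _ _).inter_finsetUnion (determinedBy_openCrossing_image _ _ _ _)).inter_finsetUnion
    ((determinedBy_openCrossing_image _ _ _ _).inter_finsetUnion (determinedBy_openCrossing_image _ _ _ _))).inter_finsetUnion
    ((determinedBy_openCrossing_image _ _ _ _).inter_finsetUnion
      ((determinedBy_openCrossing_image _ _ _ _).inter_finsetUnion (determinedBy_openCrossing_image _ _ _ _)))).inter_finsetUnion
    ((((determinedBy_openCrossing_image _ _ _ _).inter_finsetUnion (determinedBy_openCrossing_image _ _ _ _)).inter_finsetUnion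
    ((determinedBy_openCrossing_image _ _ _ _).inter_finsetUnion (determinedBy_openCrossing_image _ _ _ _))).inter_finsetUnion
    ((determinedBy_openCrossing_image _ _ _ _).inter_finsetUnion
      ((determinedBy_openCrossing_image _ _ _ _).inter_finsetUnion (determinedBy_openCrossing_image _ _ _ _))))

/-- The dual events are determined by the dual pairs. [folklore] -/
theorem determinedBy_initDualEvents (m N : ℕ) :
    DeterminedBy (initDualEvents m N) ↑(initDualPairs m N) := by
  unfold initDualEvents initDualPairs
  exact ((((determinedBy_dualFaceCrossing _ _ _).inter_finsetUnion (determinedBy_dualLRFaceCrossing _ _ _)).inter_finsetUnion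
    ((determinedBy_dualFaceCrossing _ _ _).inter_finsetUnion (determinedBy_dualLRFaceCrossing _ _ _))).inter_finsetUnion
    ((determinedBy_dualLRFaceCrossing _ _ _).inter_finsetUnion
      ((determinedBy_dualFaceCrossing _ _ _).inter_finsetUnion (determinedBy_dualLRFaceCrossing _ _ _)))).inter_finsetUnion
    ((((determinedBy_dualFaceCrossing _ _ _).inter_finsetUnion (determinedBy_dualLRFaceCrossing _ _ _)).inter_finsetUnion
    ((determinedBy_dualFaceCrossing _ _ _).inter_finsetUnion (determinedBy_dualLRFaceCrossing _ _ _))).inter_finsetUnion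
    ((determinedBy_dualLRFaceCrossing _ _ _).inter_finsetUnion
      ((determinedBy_dualFaceCrossing _ _ _).inter_finsetUnion (determinedBy_dualLRFaceCrossing _ _ _))))

end Pairs

/-! ### RSW and Harris: each class has probability `≥ c¹⁴` -/

section RSW

variable {m N : ℕ} {c : ℝ}

/-- Harris for three increasing events with a common lower bound. [folklore] -/
theorem le_real_inter3_of_upper {A₁ A₂ A₃ : Set (BondConfig (Site 2))} (hc0 : 0 ≤ c)
    (u₁ : IsUpperSet A₁) (u₂ : IsUpperSet A₂) (u₃ : IsUpperSet A₃)
    (m₁ : MeasurableSet A₁) (m₂ : MeasurableSet A₂) (m₃ : MeasurableSet A₃)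
    (h₁ : c ≤ (bondPercolation (zdGraph 2) half).real A₁) (h₂ : c ≤ (bondPercolation (zdGraph 2) half).real A₂)
    (h₃ : c ≤ (bondPercolation (zdGraph 2) half).real A₃) :
    c ^ 3 ≤ (bondPercolation (zdGraph 2) half).real (A₁ ∩ (A₂ ∩ A₃)) := by
  have e : c ^ 3 = c * (c * c) := by ring
  rw [e]
  exact le_real_inter_of_upper hc0 (by positivity) u₁ (u₂.inter u₃) m₁ (m₂.inter m₃) h₁
    (le_real_inter_of_upper hc0 hc0 u₂ u₃ m₂ m₃ h₂ h₃)

/-- Harris for three decreasing events with a common lower bound. [folklore] -/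
theorem le_real_inter3_of_lower {A₁ A₂ A₃ : Set (BondConfig (Site 2))} (hc0 : 0 ≤ c)
    (u₁ : IsLowerSet A₁) (u₂ : IsLowerSet A₂) (u₃ : IsLowerSet A₃)
    (m₁ : MeasurableSet A₁) (m₂ : MeasurableSet A₂) (m₃ : MeasurableSet A₃)
    (h₁ : c ≤ (bondPercolation (zdGraph 2) half).real A₁) (h₂ : c ≤ (bondPercolation (zdGraph 2) half).real A₂)
    (h₃ : c ≤ (bondPercolation (zdGraph 2) half).real A₃) :
    c ^ 3 ≤ (bondPercolation (zdGraph 2) half).real (A₁ ∩ (A₂ ∩ A₃)) := by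
  have e : c ^ 3 = c * (c * c) := by ring
  rw [e]
  exact le_real_inter_of_lower hc0 (by positivity) u₁ (u₂.inter u₃) m₁ (m₂.inter m₃) h₁
    (le_real_inter_of_lower hc0 hc0 u₂ u₃ m₂ m₃ h₂ h₃)

/-- One open arm's seven events have probability `≥ c⁷`. [cite: BollobasRiordan2006, Ch. 3, eq. (3)] -/
theorem le_real_openArm7 (hc0 : 0 ≤ c)
    {u₁ u₂ u₃ u₄ u₅ u₆ u₇ : Site 2} {a₁ b₁ a₂ b₂ a₃ b₃ a₄ b₄ a₅ b₅ a₆ b₆ a₇ b₇ : ℕ}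
    (h₁ : c ≤ (bondPercolation (zdGraph 2) half).real (lrCrossingAt u₁ a₁ b₁))
    (h₂ : c ≤ (bondPercolation (zdGraph 2) half).real (lrCrossingAt u₂ a₂ b₂))
    (h₃ : c ≤ (bondPercolation (zdGraph 2) half).real (tbCrossingAt' u₃ a₃ b₃))
    (h₄ : c ≤ (bondPercolation (zdGraph 2) half).real (tbCrossingAt' u₄ a₄ b₄))
    (h₅ : c ≤ (bondPercolation (zdGraph 2) half).real (lrCrossingAt u₅ a₅ b₅))
    (h₆ : c ≤ (bondPercolation (zdGraph 2) half).real (tbCrossingAt' u₆ a₆ b₆))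
    (h₇ : c ≤ (bondPercolation (zdGraph 2) half).real (tbCrossingAt' u₇ a₇ b₇)) :
    c ^ 7 ≤ (bondPercolation (zdGraph 2) half).real
      (lrCrossingAt u₁ a₁ b₁ ∩ lrCrossingAt u₂ a₂ b₂ ∩ (tbCrossingAt' u₃ a₃ b₃ ∩ tbCrossingAt' u₄ a₄ b₄) ∩
        (lrCrossingAt u₅ a₅ b₅ ∩ (tbCrossingAt' u₆ a₆ b₆ ∩ tbCrossingAt' u₇ a₇ b₇))) := by
  have e : c ^ 7 = c ^ 4 * c ^ 3 := by ring
  rw [e]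
  refine le_real_inter_of_upper (by positivity) (by positivity)
    (((isUpperSet_lrCrossingAt _ _ _).inter (isUpperSet_lrCrossingAt _ _ _)).inter
      ((isUpperSet_tbCrossingAt' _ _ _).inter (isUpperSet_tbCrossingAt' _ _ _)))
    ((isUpperSet_lrCrossingAt _ _ _).inter ((isUpperSet_tbCrossingAt' _ _ _).inter (isUpperSet_tbCrossingAt' _ _ _)))
    (((measurableSet_lrCrossingAt _ _ _).inter (measurableSet_lrCrossingAt _ _ _)).inter
      ((measurableSet_tbCrossingAt' _ _ _).inter (measurableSet_tbCrossingAt' _ _ _)))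
    ((measurableSet_lrCrossingAt _ _ _).inter ((measurableSet_tbCrossingAt' _ _ _).inter (measurableSet_tbCrossingAt' _ _ _)))
    (le_real_inter4_of_upper hc0 (isUpperSet_lrCrossingAt _ _ _) (isUpperSet_lrCrossingAt _ _ _)
      (isUpperSet_tbCrossingAt' _ _ _) (isUpperSet_tbCrossingAt' _ _ _) (measurableSet_lrCrossingAt _ _ _)
      (measurableSet_lrCrossingAt _ _ _) (measurableSet_tbCrossingAt' _ _ _) (measurableSet_tbCrossingAt' _ _ _) h₁ h₂ h₃ h₄)
    (le_real_inter3_of_upper hc0 (isUpperSet_lrCrossingAt _ _ _) (isUpperSet_tbCrossingAt' _ _ _) (isUpperSet_tbCrossingAt' _ _ _)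
      (measurableSet_lrCrossingAt _ _ _) (measurableSet_tbCrossingAt' _ _ _) (measurableSet_tbCrossingAt' _ _ _) h₅ h₆ h₇)

/-- One dual arm's seven events have probability `≥ c⁷`. [cite: BollobasRiordan2006, Ch. 3, eq. (3) and Cor. 3(i)] -/
theorem le_real_dualArm7 (hc0 : 0 ≤ c)
    {u₁ u₂ u₃ u₄ u₅ u₆ u₇ : Site 2} {a₁ b₁ a₂ b₂ a₃ b₃ a₄ b₄ a₅ b₅ a₆ b₆ a₇ b₇ : ℕ}
    (h₁ : c ≤ (bondPercolation (zdGraph 2) half).real (dualFaceCrossing u₁ a₁ b₁))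
    (h₂ : c ≤ (bondPercolation (zdGraph 2) half).real (dualLRFaceCrossing u₂ a₂ b₂))
    (h₃ : c ≤ (bondPercolation (zdGraph 2) half).real (dualFaceCrossing u₃ a₃ b₃))
    (h₄ : c ≤ (bondPercolation (zdGraph 2) half).real (dualLRFaceCrossing u₄ a₄ b₄))
    (h₅ : c ≤ (bondPercolation (zdGraph 2) half).real (dualLRFaceCrossing u₅ a₅ b₅))
    (h₆ : c ≤ (bondPercolation (zdGraph 2) half).real (dualFaceCrossing u₆ a₆ b₆))
    (h₇ : c ≤ (bondPercolation (zdGraph 2) half).real (dualLRFaceCrossing u₇ a₇ b₇)) :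
    c ^ 7 ≤ (bondPercolation (zdGraph 2) half).real
      (dualFaceCrossing u₁ a₁ b₁ ∩ dualLRFaceCrossing u₂ a₂ b₂ ∩ (dualFaceCrossing u₃ a₃ b₃ ∩ dualLRFaceCrossing u₄ a₄ b₄) ∩
        (dualLRFaceCrossing u₅ a₅ b₅ ∩ (dualFaceCrossing u₆ a₆ b₆ ∩ dualLRFaceCrossing u₇ a₇ b₇))) := by
  have e : c ^ 7 = c ^ 4 * c ^ 3 := by ring
  rw [e]
  refine le_real_inter_of_lower (by positivity) (by positivity)
    (((isLowerSet_dualFaceCrossing _ _ _).inter (isLowerSet_dualLRFaceCrossing _ _ _)).inter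
      ((isLowerSet_dualFaceCrossing _ _ _).inter (isLowerSet_dualLRFaceCrossing _ _ _)))
    ((isLowerSet_dualLRFaceCrossing _ _ _).inter ((isLowerSet_dualFaceCrossing _ _ _).inter (isLowerSet_dualLRFaceCrossing _ _ _)))
    (((measurableSet_dualFaceCrossing _ _ _).inter (measurableSet_dualLRFaceCrossing _ _ _)).inter
      ((measurableSet_dualFaceCrossing _ _ _).inter (measurableSet_dualLRFaceCrossing _ _ _)))
    ((measurableSet_dualLRFaceCrossing _ _ _).inter ((measurableSet_dualFaceCrossing _ _ _).inter (measurableSet_dualLRFaceCrossing _ _ _)))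
    (le_real_inter4_of_lower hc0 (isLowerSet_dualFaceCrossing _ _ _) (isLowerSet_dualLRFaceCrossing _ _ _)
      (isLowerSet_dualFaceCrossing _ _ _) (isLowerSet_dualLRFaceCrossing _ _ _) (measurableSet_dualFaceCrossing _ _ _)
      (measurableSet_dualLRFaceCrossing _ _ _) (measurableSet_dualFaceCrossing _ _ _) (measurableSet_dualLRFaceCrossing _ _ _) h₁ h₂ h₃ h₄)
    (le_real_inter3_of_lower hc0 (isLowerSet_dualLRFaceCrossing _ _ _) (isLowerSet_dualFaceCrossing _ _ _) (isLowerSet_dualLRFaceCrossing _ _ _)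
      (measurableSet_dualLRFaceCrossing _ _ _) (measurableSet_dualFaceCrossing _ _ _) (measurableSet_dualLRFaceCrossing _ _ _) h₅ h₆ h₇)

/-- **The fourteen open events have probability `≥ c¹⁴`** (`64 ≤ m`, `2m ≤ N ≤ 8m`, `c` the RSW
constant at aspect ratio `512`). [cite: BollobasRiordan2006, Ch. 3, eq. (3)] -/
theorem le_real_initOpenEvents (hc0 : 0 < c)
    (hc : ∀ l : ℕ, 1 ≤ l → c ≤ crossingProb half (512 * l - 1) (l - 1)) (hm : 64 ≤ m) (hmN : 2 * m ≤ N)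
    (hN8 : N ≤ 8 * m) :
    c ^ 14 ≤ (bondPercolation (zdGraph 2) half).real (initOpenEvents m N) := by
  have hc0' := hc0.le
  have e : c ^ 14 = c ^ 7 * c ^ 7 := by ring
  rw [e, initOpenEvents]
  refine le_real_inter_of_upper (by positivity) (by positivity) ?_ ?_ ?_ ?_
    (le_real_openArm7 hc0' (le_real_lrCrossingAt_of_rsw_ratio hc _ (by omega))
      (le_real_lrCrossingAt_of_rsw_ratio hc _ (by omega)) (le_real_tbCrossingAt'_of_rsw_ratio hc _ (by omega))
      (le_real_tbCrossingAt'_of_rsw_ratio hc _ (by omega)) (le_real_lrCrossingAt_of_rsw_ratio hc _ (by omega))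
      (le_real_tbCrossingAt'_of_rsw_ratio hc _ (by omega)) (le_real_tbCrossingAt'_of_rsw_ratio hc _ (by omega)))
    (le_real_openArm7 hc0' (le_real_lrCrossingAt_of_rsw_ratio hc _ (by omega))
      (le_real_lrCrossingAt_of_rsw_ratio hc _ (by omega)) (le_real_tbCrossingAt'_of_rsw_ratio hc _ (by omega))
      (le_real_tbCrossingAt'_of_rsw_ratio hc _ (by omega)) (le_real_lrCrossingAt_of_rsw_ratio hc _ (by omega))
      (le_real_tbCrossingAt'_of_rsw_ratio hc _ (by omega)) (le_real_tbCrossingAt'_of_rsw_ratio hc _ (by omega)))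
  all_goals first
    | exact (((isUpperSet_lrCrossingAt _ _ _).inter (isUpperSet_lrCrossingAt _ _ _)).inter
        ((isUpperSet_tbCrossingAt' _ _ _).inter (isUpperSet_tbCrossingAt' _ _ _))).inter
        ((isUpperSet_lrCrossingAt _ _ _).inter ((isUpperSet_tbCrossingAt' _ _ _).inter (isUpperSet_tbCrossingAt' _ _ _)))
    | exact (((measurableSet_lrCrossingAt _ _ _).inter (measurableSet_lrCrossingAt _ _ _)).inter
        ((measurableSet_tbCrossingAt' _ _ _).inter (measurableSet_tbCrossingAt' _ _ _))).inter
        ((measurableSet_lrCrossingAt _ _ _).inter ((measurableSet_tbCrossingAt' _ _ _).inter (measurableSet_tbCrossingAt' _ _ _)))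

/-- **The fourteen dual events have probability `≥ c¹⁴`.** [cite: BollobasRiordan2006, Ch. 3, eq. (3) and Cor. 3(i)] -/
theorem le_real_initDualEvents (hc0 : 0 < c)
    (hc : ∀ l : ℕ, 1 ≤ l → c ≤ crossingProb half (512 * l - 1) (l - 1)) (hm : 64 ≤ m) (hmN : 2 * m ≤ N)
    (hN8 : N ≤ 8 * m) :
    c ^ 14 ≤ (bondPercolation (zdGraph 2) half).real (initDualEvents m N) := by
  have hc0' := hc0.le
  have e : c ^ 14 = c ^ 7 * c ^ 7 := by ring
  rw [e, initDualEvents]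
  refine le_real_inter_of_lower (by positivity) (by positivity) ?_ ?_ ?_ ?_
    (le_real_dualArm7 hc0' (le_real_dualFaceCrossing_of_rsw_ratio hc _ (by omega))
      (le_real_dualLRFaceCrossing_of_rsw_ratio hc _ (by omega)) (le_real_dualFaceCrossing_of_rsw_ratio hc _ (by omega))
      (le_real_dualLRFaceCrossing_of_rsw_ratio hc _ (by omega)) (le_real_dualLRFaceCrossing_of_rsw_ratio hc _ (by omega))
      (le_real_dualFaceCrossing_of_rsw_ratio hc _ (by omega)) (le_real_dualLRFaceCrossing_of_rsw_ratio hc _ (by omega)))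
    (le_real_dualArm7 hc0' (le_real_dualFaceCrossing_of_rsw_ratio hc _ (by omega))
      (le_real_dualLRFaceCrossing_of_rsw_ratio hc _ (by omega)) (le_real_dualFaceCrossing_of_rsw_ratio hc _ (by omega))
      (le_real_dualLRFaceCrossing_of_rsw_ratio hc _ (by omega)) (le_real_dualLRFaceCrossing_of_rsw_ratio hc _ (by omega))
      (le_real_dualFaceCrossing_of_rsw_ratio hc _ (by omega)) (le_real_dualLRFaceCrossing_of_rsw_ratio hc _ (by omega)))
  all_goals first
    | exact (((isLowerSet_dualFaceCrossing _ _ _).inter (isLowerSet_dualLRFaceCrossing _ _ _)).inter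
        ((isLowerSet_dualFaceCrossing _ _ _).inter (isLowerSet_dualLRFaceCrossing _ _ _))).inter
        ((isLowerSet_dualLRFaceCrossing _ _ _).inter ((isLowerSet_dualFaceCrossing _ _ _).inter (isLowerSet_dualLRFaceCrossing _ _ _)))
    | exact (((measurableSet_dualFaceCrossing _ _ _).inter (measurableSet_dualLRFaceCrossing _ _ _)).inter
        ((measurableSet_dualFaceCrossing _ _ _).inter (measurableSet_dualLRFaceCrossing _ _ _))).inter
        ((measurableSet_dualLRFaceCrossing _ _ _).inter ((measurableSet_dualFaceCrossing _ _ _).inter (measurableSet_dualLRFaceCrossing _ _ _)))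

end RSW

/-! ### Positivity at bounded ratio -/

section Main

variable {m N : ℕ} {c : ℝ}

/-- **`c²⁸ ≤ P_{1/2}(zdFourArmSep m N)` for `64 ≤ m`, `2m ≤ N ≤ 8m`** (`c` the RSW constant at aspect
ratio `512`): the open and dual classes are independent (disjoint pair sets), each has probability
`≥ c¹⁴`, and together they give the well-separated event (`mem_zdFourArmSep_of_mem_init`).  The
initial-scale input of the inward summation of Kesten's scheme. [cite: Nolin2008, §4.3 Prop. 13, lower bound (arXiv 0711.4948: Prop. 12)] [cite: KestenScalingCMP1987, §2 Lemma 5] -/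
theorem le_real_zdFourArmSep_init (hm : 64 ≤ m) (hmN : 2 * m ≤ N) (hN8 : N ≤ 8 * m) (hc0 : 0 < c)
    (hc : ∀ l : ℕ, 1 ≤ l → c ≤ crossingProb half (512 * l - 1) (l - 1)) :
    c ^ 28 ≤ (bondPercolation (zdGraph 2) half).real (zdFourArmSep m N) := by
  have hdisj : Disjoint (↑(initOpenPairs m N) : Set (Sym2 (Site 2))) ↑(initDualPairs m N) :=
    Finset.disjoint_coe.2 (disjoint_initPairs hm hmN hN8)
  have dA := determinedBy_initOpenEvents m N
  have dB := determinedBy_initDualEvents m N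
  have hind := bondPercolation_real_inter_of_disjoint (zdGraph 2) half hdisj dA dB
    dA.measurableSet_of_finset dB.measurableSet_of_finset
  have hA := le_real_initOpenEvents hc0 hc hm hmN hN8
  have hB := le_real_initDualEvents hc0 hc hm hmN hN8
  calc c ^ 28 = c ^ 14 * c ^ 14 := by ring
    _ ≤ (bondPercolation (zdGraph 2) half).real (initOpenEvents m N) *
          (bondPercolation (zdGraph 2) half).real (initDualEvents m N) :=
        mul_le_mul hA hB (by positivity) measureReal_nonneg
    _ = (bondPercolation (zdGraph 2) half).real (initOpenEvents m N ∩ initDualEvents m N) := hind.symm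
    _ ≤ (bondPercolation (zdGraph 2) half).real (zdFourArmSep m N) := by
        refine ENNReal.toReal_mono (measure_ne_top _ _) (measure_mono_ae ?_)
        have hae : ∀ᵐ ω ∂(bondPercolation (zdGraph 2) half), ω ⊆ (zdGraph 2).edgeSet :=
          ProbabilityTheory.setBernoulli_ae_subset
        filter_upwards [hae] with ω hω h
        exact mem_zdFourArmSep_of_mem_init hω hm hmN h

/-- **Positivity of the well-separated four-arm event at bounded ratio**, packaged: there is `c > 0`
with `c ≤ P_{1/2}(zdFourArmSep m N)` for all `64 ≤ m`, `2m ≤ N ≤ 8m`. [cite: Nolin2008, §4.3 Prop. 13, lower bound (arXiv 0711.4948: Prop. 12)] -/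
theorem exists_le_real_zdFourArmSep_init :
    ∃ c : ℝ, 0 < c ∧ ∀ m N : ℕ, 64 ≤ m → 2 * m ≤ N → N ≤ 8 * m →
      c ≤ (bondPercolation (zdGraph 2) half).real (zdFourArmSep m N) := by
  obtain ⟨c, hc0, hc⟩ := rsw_lowerBound_holds 512 (by norm_num)
  exact ⟨c ^ 28, by positivity, fun m N hm hmN hN8 => le_real_zdFourArmSep_init hm hmN hN8 hc0 hc⟩

end Main

end Literature.Probability.Percolation

end
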